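import Literature.AlgebraicGeometry.HodgeTheory.FermatSurfaceLineRestrictions
import Literature.AlgebraicGeometry.HodgeTheory.FermatJuxtapositionSpans
import Mathlib.FieldTheory.IsAlgClosed.Basic
import HarnessLib

/-!
# The lines of the Fermat surface represent the characters `(a, -a, b, -b)`: `Shioda1979_lines_represent` holds

Family `hodge`, layer `Literature/AlgebraicGeometry/HodgeTheory`. DISCHARGE of the named fact
`Shioda1979_lines_represent` (`FermatJuxtapositionSpans`; Aoki, J. Math. Soc. Japan 39 (1987) Thm. 1-1
p. 386 "the linear space `L` represents `δ`" for `r = 1`, and Thm. 1-4 (i) with `r = s = 0`; Shioda,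
Math. Ann. 245 (1979) Thm. I; Ran, Compositio Math. 42 (1980) Prop. 1.14): for Hodge characters
`α = (a, -a)`, `β = (b, -b)` of `X⁰ₘ`, the class `φ_* 1 ∈ H²(X²ₘ(ℂ); ℂ)` of a line `φ : ℙ¹ → X²ₘ` of the
Fermat surface has non-zero `(α∗β)`-component. Everything is PROVED, on the tree's real carriers, for
the line `L₀ = L(u₀, u₀) : x₀ = u₀ x₁, x₂ = u₀ x₃` (`u₀ᵐ = -1`) and the complex orientation family:

* `FermatSurface.sum_inv_fermatCharacter_mul_indicator_eq_zero` — a character sum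
  `Σ_{a ∈ μₘ⁴} χ(a)⁻¹ [P a]` vanishes when `P` is invariant under translation by some `g` with `χ(g) ≠ 1`;
* `FermatSurface.fermatCharacter_eq_one_of_eq` — `χ_δ(a) = 1` if `a₀ = a₁`, `a₂ = a₃` and
  `δ₀ + δ₁ = 0 = δ₂ + δ₃`;
* `FermatSurface.fermatProjector_lineClass_ne_zero` — **`π_δ cl(L₀) ≠ 0` for `δ = (δ₀, δ₁, δ₂, δ₃)` with
  `δ₀, δ₂ ≠ 0`, `δ₀ + δ₁ = 0 = δ₂ + δ₃`**. Proof: `π_δ = |G|⁻¹ Σ_a χ_δ(a)⁻¹ g_a^*` and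
  `g_a^* cl L₀ = cl(a⁻¹ L₀)` (`FermatSurfaceLineClassesEquivariance`); restricting to `L₀`
  (`FermatSurface.line_restrictions`: `cl(a⁻¹L₀)|_{L₀} = c(a) η` with `c = (1 - κ) t, t, t, 0`
  according as `a⁻¹ L₀` is `L₀`, meets it, or is skew) gives
  `(π_δ cl L₀)|_{L₀} = |G|⁻¹ t (S₁ + S₂ - (1 + κ) N) η` with `S₁ = Σ χ⁻¹ [a₀ = a₁] = 0`,
  `S₂ = Σ χ⁻¹ [a₂ = a₃] = 0` (translation by `(1,1,ζ,1)`, `(ζ,1,1,1)`), and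
  `N = #{a | a₀ = a₁, a₂ = a₃} ≠ 0` (`χ_δ = 1` there), i.e. `-|G|⁻¹ (1 + κ) t N η ≠ 0` — in print the
  eigenvalue `-m` of the intersection matrix `(L_{jk} · L_{j'k'})` on the character `(a, b)`, `a, b ≠ 0`;
* `Shioda1979_lines_represent_holds` — the named fact (`δ = α∗β`, `u₀` any root of `-1`).

No definitions, no named facts introduced.

## References

* [Aoki1987] N. Aoki, Some new algebraic cycles on Fermat varieties, J. Math. Soc. Japan 39 (1987),
  Thm. 1-1 p. 386, Thm. 1-4 (i) p. 388.
* [Shioda1979HodgeFermat] T. Shioda, The Hodge conjecture for Fermat varieties, Math. Ann. 245 (1979),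
  §1 and Thm. I.
* [Ran1980] Z. Ran, Cycles on Fermat hypersurfaces, Compositio Math. 42 (1980), §1 Prop. 1.14.
* [SerreLinearRepresentations1977] J.-P. Serre, Linear Representations of Finite Groups, §2.6 Thm. 8.
-/

noncomputable section

open scoped LinearAlgebra.Projectivization
open CategoryTheory AlgebraicGeometry MvPolynomial
open Literature.AlgebraicGeometry.Motives Literature.AlgebraicTopology.SingularHomology
open Literature.NumberTheory.Transcendental

namespace Literature.AlgebraicGeometry.HodgeTheory

namespace FermatSurface

variable {m : ℕ}

/-! ### Character sums over `μₘ⁴` -/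

/-- **A twisted indicator sum over a finite group vanishes**: if the predicate `P` is invariant under
right translation by `g` and `χ(g) ≠ 1`, then `Σ_a χ(a)⁻¹ [P a] = 0` (reindex by `a ↦ a g`:
the sum gets multiplied by `χ(g)⁻¹ ≠ 1`). [cite: SerreLinearRepresentations1977, §2.6 Thm. 8] -/
theorem sum_inv_fermatCharacter_mul_indicator_eq_zero [NeZero m] (χ : fermatGroup (2 * 1) m →* ℂˣ)
    (P : fermatGroup (2 * 1) m → Prop) [DecidablePred P] (g : fermatGroup (2 * 1) m)
    (hP : ∀ a, P (a * g) ↔ P a) (hg : χ g ≠ 1) :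
    ∑ a, ((χ a : ℂˣ) : ℂ)⁻¹ * (if P a then 1 else 0) = 0 := by
  set T := ∑ a, ((χ a : ℂˣ) : ℂ)⁻¹ * (if P a then (1 : ℂ) else 0) with hT
  have hre : T = ((χ g : ℂˣ) : ℂ)⁻¹ * T := by
    rw [hT, Finset.mul_sum]
    refine (Fintype.sum_equiv (Equiv.mulRight g) _ _ fun a ↦ ?_).symm
    rw [Equiv.coe_mulRight, map_mul, Units.val_mul, mul_inv, if_congr (hP a) rfl rfl]
    ring
  have hg' : ((χ g : ℂˣ) : ℂ)⁻¹ ≠ 1 := by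
    rw [Ne, inv_eq_one, Units.val_eq_one]
    exact hg
  have h : (1 - ((χ g : ℂˣ) : ℂ)⁻¹) * T = 0 := by rw [sub_mul, one_mul, ← hre, sub_self]
  exact (mul_eq_zero.mp h).resolve_left (sub_ne_zero.mpr (Ne.symm hg'))

/-- **`χ_δ(a) = 1` when `a₀ = a₁`, `a₂ = a₃` and `δ₀ + δ₁ = 0 = δ₂ + δ₃`**:
`χ_δ(a) = a₀^{⟨δ₀⟩ + ⟨δ₁⟩} a₂^{⟨δ₂⟩ + ⟨δ₃⟩}` and `m` divides both exponents. [cite: Shioda1979HodgeFermat, §1] -/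
theorem fermatCharacter_eq_one_of_eq [NeZero m] (δ : Fin (2 * 1 + 2) → ZMod m) (h01 : δ 0 + δ 1 = 0)
    (h23 : δ 2 + δ 3 = 0) (a : fermatGroup (2 * 1) m)
    (ha01 : (a : Fin (2 * 1 + 2) → ℂˣ) 0 = (a : Fin (2 * 1 + 2) → ℂˣ) 1)
    (ha23 : (a : Fin (2 * 1 + 2) → ℂˣ) 2 = (a : Fin (2 * 1 + 2) → ℂˣ) 3) :
    fermatCharacter m δ a = 1 := by
  have hpow : ∀ i, (a : Fin (2 * 1 + 2) → ℂˣ) i ^ m = 1 := mem_fermatGroup_iff.mp a.2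
  have hdvd : ∀ {x y : ZMod m}, x + y = 0 → m ∣ x.val + y.val := by
    intro x y hxy
    refine (ZMod.natCast_eq_zero_iff _ _).mp ?_
    push_cast
    rw [ZMod.natCast_zmod_val, ZMod.natCast_zmod_val, hxy]
  obtain ⟨k, hk⟩ := hdvd h01
  obtain ⟨k', hk'⟩ := hdvd h23
  rw [fermatCharacter_apply, Fin.prod_univ_four]
  change (a : Fin (2 * 1 + 2) → ℂˣ) 0 ^ (δ 0).val * (a : Fin (2 * 1 + 2) → ℂˣ) 1 ^ (δ 1).val *
    (a : Fin (2 * 1 + 2) → ℂˣ) 2 ^ (δ 2).val * (a : Fin (2 * 1 + 2) → ℂˣ) 3 ^ (δ 3).val = 1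
  rw [ha01, ha23, ← pow_add, mul_assoc, ← pow_add, hk, hk', pow_mul, pow_mul, hpow 1, hpow 3,
    one_pow, one_pow, one_mul]

/-- The element `(1, …, ζ, …, 1)` has coordinate `1` off the slot `i`. [folklore] -/
theorem fermatGroupSingle_apply_of_ne (i j : Fin (2 * 1 + 2)) (hij : j ≠ i) (ζ : rootsOfUnity m ℂ) :
    ((fermatGroupSingle (n := 2 * 1) i ζ : fermatGroup (2 * 1) m) : Fin (2 * 1 + 2) → ℂˣ) j = 1 := by
  rw [fermatGroupSingle, fermatGroupEquiv_apply_coe, Pi.mulSingle_eq_of_ne hij]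
  rfl

/-! ### `π_δ cl(L₀) ≠ 0` -/

/-- **The `δ`-component of the class of a line of the Fermat surface is non-zero** for every
character `δ = (δ₀, δ₁, δ₂, δ₃)` with `δ₀, δ₂ ≠ 0` and `δ₀ + δ₁ = 0 = δ₂ + δ₃` — Aoki's Thm. 1-1
"`L` represents `δ`" for `r = 1` (`ω_δ(L) ≠ 0`), equivalently the non-vanishing on the character
`(a, b) = (δ₀, δ₂)` of the circulant intersection matrix of the `m²` lines `L(u, u')` (eigenvalue
`-m`, Ran Prop. 1.14), here for `L₀ = L(u₀, u₀')` and the complex orientation family. Proof in the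
module docstring: expand `π_δ = |G|⁻¹ Σ χ⁻¹ g_a^*`, use `g_a^* cl L₀ = cl a⁻¹L₀`, restrict to `L₀`
(`line_restrictions`), and evaluate the character sums.
[cite: Aoki1987, Thm. 1-1 p. 386] [cite: Ran1980, §1 Prop. 1.14] [cite: Shioda1979HodgeFermat, Thm. I] -/
theorem fermatProjector_lineClass_ne_zero [NeZero m] (δ : Fin (2 * 1 + 2) → ZMod m) (hδ0 : δ 0 ≠ 0)
    (hδ2 : δ 2 ≠ 0) (h01 : δ 0 + δ 1 = 0) (h23 : δ 2 + δ 3 = 0) {u₀ u₀' : ℂ} (hu₀ : u₀ ^ m = -1)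
    (hu₀' : u₀' ^ m = -1) :
    fermatProjector m δ (2 * 1)
      (lineClass complexOrientationFamily m (pair u₀ u₀') (pair_pow hu₀ hu₀') NeZero.one_le) ≠ 0 := by
  classical
  -- `m ≥ 2` (a non-zero residue exists)
  have hm2 : 2 ≤ m := by
    by_contra h
    have h1 : m = 1 := by have := NeZero.one_le (n := m); omega
    subst h1
    exact hδ0 (Subsingleton.elim _ _)
  -- a hyperplane class and the restrictions to `L₀`
  obtain ⟨r, hr⟩ := exists_complexBetti_projectiveSpace_ne_zero (2 * 1 + 1) (by norm_num)
  obtain ⟨t, κ, ht, hη, hval⟩ := line_restrictions hm2 hu₀ hu₀' hr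
  set ρ := complexBetti.map (lineEmb m (pair u₀ u₀') (pair_pow hu₀ hu₀')) (2 * 1) with hρ
  set η := ρ (complexBetti.map (SmoothHypersurface.hypersurfaceι (fermatPolynomial ℂ (2 * 1) m)) (2 * 1) r) with hηdef
  intro h0
  have h1 := congrArg ρ h0
  rw [map_zero, eigenProjector_apply, map_smul, map_sum] at h1
  -- each term restricted to `L₀`
  let P₁ : fermatGroup (2 * 1) m → Prop := fun a ↦ (a : Fin (2 * 1 + 2) → ℂˣ) 0 = (a : Fin (2 * 1 + 2) → ℂˣ) 1
  let P₂ : fermatGroup (2 * 1) m → Prop := fun a ↦ (a : Fin (2 * 1 + 2) → ℂˣ) 2 = (a : Fin (2 * 1 + 2) → ℂˣ) 3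
  let coef : fermatGroup (2 * 1) m → ℂ := fun a ↦
    t * (if P₁ a then 1 else 0) + t * (if P₂ a then 1 else 0) -
      (1 + κ) * t * ((if P₁ a then 1 else 0) * (if P₂ a then 1 else 0))
  have hterm : ∀ a : fermatGroup (2 * 1) m, ρ (((fermatCharacter m δ a : ℂˣ) : ℂ)⁻¹ •
      singularCohomology.map ℂ ℂ (diagonalMap (fermatPolynomial ℂ (2 * 1) m)
        (fermatGroup_le_diagonalStabilizer m a.2)) (2 * 1)
        (lineClass complexOrientationFamily m (pair u₀ u₀') (pair_pow hu₀ hu₀') NeZero.one_le)) =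
      (((fermatCharacter m δ a : ℂˣ) : ℂ)⁻¹ * coef a) • η := by
    intro a
    rw [map_smul, map_diagonalMap_lineClass NeZero.one_le a.2, hval _ a.2, smul_smul]
    congr 1
    change _ = _ * (t * (if P₁ a then 1 else 0) + t * (if P₂ a then 1 else 0) -
      (1 + κ) * t * ((if P₁ a then 1 else 0) * (if P₂ a then 1 else 0)))
    congr 1
    change (if P₁ a then (if P₂ a then (1 - (κ : ℂ)) * t else t) else (if P₂ a then t else 0)) = _
    split_ifs <;> ring
  simp_rw [hterm] at h1
  rw [← Finset.sum_smul] at h1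
  -- the character sums
  have hζ := Complex.isPrimitiveRoot_exp m (NeZero.ne m)
  set ζ : rootsOfUnity m ℂ := hζ.toRootsOfUnity with hζdef
  have hζu : IsPrimitiveRoot (ζ : ℂˣ) m :=
    IsPrimitiveRoot.coe_units_iff.mp (by simpa [hζdef] using hζ)
  have hχne : ∀ i, δ i ≠ 0 → fermatCharacter m δ (fermatGroupSingle i ζ) ≠ 1 := by
    intro i hi h
    rw [fermatCharacter_fermatGroupSingle] at h
    have hlt : (δ i).val < m := ZMod.val_lt _
    exact hζu.pow_ne_one_of_pos_of_lt ((ZMod.val_ne_zero _).mpr hi) hlt h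
  have hS₁ : ∑ a : fermatGroup (2 * 1) m, ((fermatCharacter m δ a : ℂˣ) : ℂ)⁻¹ * (if P₁ a then 1 else 0) = 0 := by
    refine sum_inv_fermatCharacter_mul_indicator_eq_zero _ P₁ (fermatGroupSingle 2 ζ) (fun a ↦ ?_)
      (hχne 2 hδ2)
    change (a : Fin (2 * 1 + 2) → ℂˣ) 0 * _ = (a : Fin (2 * 1 + 2) → ℂˣ) 1 * _ ↔ _
    rw [fermatGroupSingle_apply_of_ne 2 0 (by decide), fermatGroupSingle_apply_of_ne 2 1 (by decide),
      mul_left_inj]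
  have hS₂ : ∑ a : fermatGroup (2 * 1) m, ((fermatCharacter m δ a : ℂˣ) : ℂ)⁻¹ * (if P₂ a then 1 else 0) = 0 := by
    refine sum_inv_fermatCharacter_mul_indicator_eq_zero _ P₂ (fermatGroupSingle 0 ζ) (fun a ↦ ?_)
      (hχne 0 hδ0)
    change (a : Fin (2 * 1 + 2) → ℂˣ) 2 * _ = (a : Fin (2 * 1 + 2) → ℂˣ) 3 * _ ↔ _
    rw [fermatGroupSingle_apply_of_ne 0 2 (by decide), fermatGroupSingle_apply_of_ne 0 3 (by decide),
      mul_left_inj]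
  have hN : ∑ a : fermatGroup (2 * 1) m, ((fermatCharacter m δ a : ℂˣ) : ℂ)⁻¹ *
      ((if P₁ a then 1 else 0) * (if P₂ a then 1 else 0)) =
      ((Finset.univ.filter fun a : fermatGroup (2 * 1) m ↦ P₁ a ∧ P₂ a).card : ℂ) := by
    rw [Finset.natCast_card_filter]
    refine Finset.sum_congr rfl fun a _ ↦ ?_
    by_cases h1a : P₁ a
    · by_cases h2a : P₂ a
      · rw [if_pos h1a, if_pos h2a, if_pos (show P₁ a ∧ P₂ a from ⟨h1a, h2a⟩),
          fermatCharacter_eq_one_of_eq δ h01 h23 a h1a h2a]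
        simp
      · rw [if_neg h2a, if_neg (show ¬(P₁ a ∧ P₂ a) from fun h ↦ h2a h.2)]; simp
    · rw [if_neg h1a, if_neg (show ¬(P₁ a ∧ P₂ a) from fun h ↦ h1a h.1)]; simp
  have hNpos : ((Finset.univ.filter fun a : fermatGroup (2 * 1) m ↦ P₁ a ∧ P₂ a).card : ℂ) ≠ 0 := by
    rw [Nat.cast_ne_zero, ← Nat.pos_iff_ne_zero, Finset.card_pos]
    exact ⟨1, Finset.mem_filter.mpr ⟨Finset.mem_univ _, rfl, rfl⟩⟩
  have hC : ∑ a : fermatGroup (2 * 1) m, ((fermatCharacter m δ a : ℂˣ) : ℂ)⁻¹ * coef a =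
      -((1 + κ) * t * ((Finset.univ.filter fun a : fermatGroup (2 * 1) m ↦ P₁ a ∧ P₂ a).card : ℂ)) := by
    have hexp : ∀ a : fermatGroup (2 * 1) m, ((fermatCharacter m δ a : ℂˣ) : ℂ)⁻¹ * coef a =
        t * (((fermatCharacter m δ a : ℂˣ) : ℂ)⁻¹ * (if P₁ a then 1 else 0)) +
        t * (((fermatCharacter m δ a : ℂˣ) : ℂ)⁻¹ * (if P₂ a then 1 else 0)) -
        (1 + κ) * t * (((fermatCharacter m δ a : ℂˣ) : ℂ)⁻¹ *
          ((if P₁ a then 1 else 0) * (if P₂ a then 1 else 0))) := fun a ↦ by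
      change _ * (t * (if P₁ a then 1 else 0) + t * (if P₂ a then 1 else 0) -
        (1 + κ) * t * ((if P₁ a then 1 else 0) * (if P₂ a then 1 else 0))) = _
      ring
    simp_rw [hexp]
    rw [Finset.sum_sub_distrib, Finset.sum_add_distrib, ← Finset.mul_sum, ← Finset.mul_sum,
      ← Finset.mul_sum, hS₁, hS₂, hN]
    ring
  rw [hC] at h1
  -- contradiction: a non-zero multiple of `η` vanishes
  have hne : ((Fintype.card (fermatGroup (2 * 1) m) : ℂ)⁻¹ • (-((1 + κ) * t *
      ((Finset.univ.filter fun a : fermatGroup (2 * 1) m ↦ P₁ a ∧ P₂ a).card : ℂ))) • η) ≠ 0 := by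
    refine smul_ne_zero (inv_ne_zero (Nat.cast_ne_zero.mpr Fintype.card_ne_zero)) (smul_ne_zero ?_ hη)
    refine neg_ne_zero.mpr (mul_ne_zero (mul_ne_zero ?_ ht) hNpos)
    rw [add_comm]
    exact_mod_cast Nat.succ_ne_zero κ
  exact hne h1

end FermatSurface

/-! ### The named fact -/

/-- **`Shioda1979_lines_represent` holds** (Aoki 1987, Thm. 1-1 p. 386 and Thm. 1-4 (i) with
`r = s = 0`; Shioda 1979, Thm. I): for Hodge characters `α = (a, -a)`, `β = (b, -b)` of `X⁰ₘ` the
line `L₀ = L(u₀, u₀) : x₀ = u₀ x₁, x₂ = u₀ x₃` (`u₀ᵐ = -1`) of the Fermat surface `X²ₘ`, embedded by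
`φ : ℙ¹ ⟶ X²ₘ`, has `π_{α∗β}(φ_* 1) ≠ 0` for the complex orientation family
(`FermatSurface.fermatProjector_lineClass_ne_zero` with `δ = α∗β`: `δ₀ = a ≠ 0`, `δ₂ = b ≠ 0`,
`δ₀ + δ₁ = 0 = δ₂ + δ₃`). [cite: Aoki1987, Thm. 1-1 p. 386 and Thm. 1-4 (i) p. 388]
[cite: Shioda1979HodgeFermat, Thm. I] -/
theorem Shioda1979_lines_represent_holds : Shioda1979_lines_represent := by
  intro m _ α β hα hβ
  obtain ⟨u₀, hu₀⟩ := IsAlgClosed.exists_pow_nat_eq (-1 : ℂ) (NeZero.pos m)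
  have h01 : α 0 + α 1 = 0 := by simpa [Fin.sum_univ_two] using hα.1.2
  have h23 : β 0 + β 1 = 0 := by simpa [Fin.sum_univ_two] using hβ.1.2
  exact ⟨complexOrientationFamily, 1, Motives.projectiveSpace 1 ℂ, isSmoothProjective_projectiveSpace' 1,
    FermatSurface.isSmoothProjective_X NeZero.one_le,
    FermatSurface.lineEmb m (FermatSurface.pair u₀ u₀) (FermatSurface.pair_pow hu₀ hu₀), rfl,
    FermatSurface.fermatProjector_lineClass_ne_zero (FermatCharacter.append α β) (hα.1.1 0) (hβ.1.1 0)
      h01 h23 hu₀ hu₀⟩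

end Literature.AlgebraicGeometry.HodgeTheory

end
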